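import Summits.CriticalPhenomena.SAWScalingLimit.Theorems.SAWTotalPositivityCriticalBubbleBoundKestenCutExponents
import Summits.CriticalPhenomena.SAWScalingLimit.Theorems.SAWTotalPositivityCriticalBubbleBoundKestenColumnMassLeOne
import Summits.CriticalPhenomena.SAWScalingLimit.Theorems.SAWRenewalTightnessStripMassConservation
import HarnessLib

/-!
# Line `kesten-product-renewal-dictionary` for the crux `SAWTotalPositivity.CriticalBubbleBound`
(stmt-CriticalPhenomena-7117): stub H7 — the EFFECTIVE floor under B1 (`Λ_h`, `sup_{v₀ = h} L(v)`, `F(h)`)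

The line's objects (`Theorems/SAWTotalPositivityCriticalBubbleBoundKestenDefs.lean`, Madras–Slade §4.2): a
`Bridge` of `ℤ²` from the origin of any length with its `span` (first coordinate of the tip) and critical
`mass = x_c^{|W|}`; the length-weighted pinned mass `L(v) = pinnedLengthMass v = Σ_{tip W = v} |W| x_c^{|W|}`;
the renewal density `u_h = columnMass h`; the free pair mass `F(h) = freePairMass h`.

**Hypothesis** (stub H6 of the line, word model of `SAWWords.lean` / `SAWWordBridges.lean`, from the critical
Hammersley–Welsh product bound, Madras–Slade §3.1): for all `N h`,
`Σ_{w self-avoiding bridge word, span w = h, |w| ≤ N} |w| x_c^{|w|} ≤ 2 μ 4^h` (`μ = connectiveConstant`).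

**Proved here** (`pinnedLengthMass_le_exp_of`), the transfer of that bound to the vertex-function objects:
* (a) `Λ_h := Σ'_{W : Bridge, span W = h} |W| x_c^{|W|} ≤ ENNReal.ofReal (2 μ 4^h)`: slice the `tsum` over
  `Bridge = Σ n, Zd.bridges 2 n` by length (`ENNReal.tsum_sigma'`, `Finset.tsum_subtype`), write it as the
  supremum of its partial sums (`ENNReal.tsum_eq_iSup_nat`), and bound each partial sum in `ℝ` by the word sum
  through the injection `ω ↦ wordOf n ω` of vertex-function bridges of span `h` into bridge words of span `h`
  (`StripMass.card_bridges_filter_le`) and the disjointness of the word sets of different lengths;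
* (b) `L(v) ≤ Λ_{v₀}` termwise (`tip W = v ⇒ span W = v₀`), hence `sup_{v₀ = h} L(v) ≤ ENNReal.ofReal (2 μ 4^h)`;
* (c) `F(h) ≤ 2 u_h · sup_{v₀ = h} L(v) ≤ 2 · ENNReal.ofReal (2 μ 4^h)` by the landed Fubini step
  `Kesten.Cut.freePairMass_le` and Kesten's bound `Kesten.Cut.columnMass_le_one` (`u_h ≤ 1`).

This replaces the ineffective (strip-gap) constant of `Strip.exists_pinnedLengthMass_le_of_column` by the
explicit `2 μ 4^h`; it is still exponential in `h`, whereas the open stub B1 asks for `C (h+1)^{1/5}`.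

Sources: N. Madras, G. Slade, *The Self-Avoiding Walk* (1993), Definition 1.2.4, §1.1 (words vs vertex
functions), §3.1 (Hammersley–Welsh), §4.2 (Kesten's renewal structure); H. Kesten, J. Math. Phys. 4 (1963), §4.
Deliberately NOT here: the hypothesis H6 itself (another file of the line) and any polynomial bound (stub B1).
-/

noncomputable section

open Literature.Probability.LatticeModels
open Literature.Probability.RandomPlanarGeometry Literature.Probability.RandomPlanarGeometry.SAW
open scoped ENNReal NNReal BigOperators
open Classical

namespace Summit.CriticalPhenomena.SAWScalingLimit.Theorems.CriticalBubbleBound.Kesten.HW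

/-! ## `Λ_h` sliced by length -/

/-- `Λ_h` as a series over the length:
`Σ'_{W : Bridge, span W = h} |W| x_c^{|W|} = Σ_n Σ_{ω ∈ bridges 2 n, ω₁(n) = h} n x_c^n`. [folklore] -/
theorem spanLengthMass_eq_tsum_sum (h : ℕ) :
    (∑' W : Bridge, if W.span = (h : ℤ) then (W.len : ℝ≥0∞) * W.mass else 0) =
      ∑' n : ℕ, ∑ _ω ∈ (Zd.bridges 2 n).filter (fun ω => ω n 0 = (h : ℤ)),
        (n : ℝ≥0∞) * ENNReal.ofReal (criticalFugacity ^ n) := by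
  rw [ENNReal.tsum_sigma']
  refine tsum_congr fun n => ?_
  rw [Finset.sum_filter]
  exact Finset.tsum_subtype (Zd.bridges 2 n)
    (fun ω => if ω n 0 = (h : ℤ) then (n : ℝ≥0∞) * ENNReal.ofReal (criticalFugacity ^ n) else 0)

/-- The partial sums of that series, pushed through `ENNReal.ofReal` (all terms are non-negative reals).
[folklore] -/
theorem sum_range_lengthMass_eq_ofReal (h N : ℕ) :
    ∑ n ∈ Finset.range (N + 1), ∑ _ω ∈ (Zd.bridges 2 n).filter (fun ω => ω n 0 = (h : ℤ)),
        (n : ℝ≥0∞) * ENNReal.ofReal (criticalFugacity ^ n) =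
      ENNReal.ofReal (∑ n ∈ Finset.range (N + 1),
        ∑ _ω ∈ (Zd.bridges 2 n).filter (fun ω => ω n 0 = (h : ℤ)), (n : ℝ) * criticalFugacity ^ n) := by
  have hx : 0 ≤ criticalFugacity := StripMass.criticalFugacity_pos.le
  have hn : ∀ n : ℕ, 0 ≤ (n : ℝ) * criticalFugacity ^ n := fun n =>
    mul_nonneg n.cast_nonneg (pow_nonneg hx n)
  rw [ENNReal.ofReal_sum_of_nonneg fun n _ => Finset.sum_nonneg fun _ _ => hn n]
  refine Finset.sum_congr rfl fun n _ => ?_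
  rw [ENNReal.ofReal_sum_of_nonneg fun _ _ => hn n]
  refine Finset.sum_congr rfl fun _ _ => ?_
  rw [ENNReal.ofReal_mul n.cast_nonneg, ENNReal.ofReal_natCast]

/-- **Transfer to the word model.** The real partial sums of `Λ_h` are bounded by the length-weighted
critical mass of the self-avoiding bridge WORDS of span `h` and length `≤ N`: for each length `n` the
vertex-function bridges of span `h` inject into the bridge words of span `h` (`StripMass.card_bridges_filter_le`,
reading off the step word), and the word sets of different lengths are disjoint. [cite: MadrasSlade1993, §1.1] -/
theorem sum_range_lengthMass_le_wordSum (h N : ℕ) :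
    ∑ n ∈ Finset.range (N + 1), ∑ _ω ∈ (Zd.bridges 2 n).filter (fun ω => ω n 0 = (h : ℤ)),
        (n : ℝ) * criticalFugacity ^ n ≤
      ∑ w ∈ (Finset.range (N + 1)).biUnion
          (fun n => (sawWords n).filter (fun w => IsBridgeW w ∧ xEnd w = (h : ℤ))),
        (w.length : ℝ) * criticalFugacity ^ w.length := by
  have hxc : 0 ≤ criticalFugacity := StripMass.criticalFugacity_pos.le
  -- per length `n`: both inner sums are constant sums, compare the cardinalities
  have hstep : ∀ n : ℕ,
      ∑ _ω ∈ (Zd.bridges 2 n).filter (fun ω => ω n 0 = (h : ℤ)), (n : ℝ) * criticalFugacity ^ n ≤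
        ∑ w ∈ (sawWords n).filter (fun w => IsBridgeW w ∧ xEnd w = (h : ℤ)),
          (w.length : ℝ) * criticalFugacity ^ w.length := by
    intro n
    have h2 : ∑ w ∈ (sawWords n).filter (fun w => IsBridgeW w ∧ xEnd w = (h : ℤ)),
        (w.length : ℝ) * criticalFugacity ^ w.length =
        ∑ _w ∈ (sawWords n).filter (fun w => IsBridgeW w ∧ xEnd w = (h : ℤ)),
          (n : ℝ) * criticalFugacity ^ n :=
      Finset.sum_congr rfl fun w hw => by rw [(mem_sawWords.1 (Finset.mem_filter.1 hw).1).1]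
    rw [h2, Finset.sum_const, Finset.sum_const, nsmul_eq_mul, nsmul_eq_mul]
    exact mul_le_mul_of_nonneg_right (Nat.cast_le.2 (StripMass.card_bridges_filter_le n h))
      (mul_nonneg n.cast_nonneg (pow_nonneg hxc _))
  -- the sets of words of different lengths are disjoint
  have hdisj : Set.PairwiseDisjoint (↑(Finset.range (N + 1)) : Set ℕ)
      (fun n => (sawWords n).filter (fun w => IsBridgeW w ∧ xEnd w = (h : ℤ))) := by
    intro m _ n _ hmn
    rw [Function.onFun, Finset.disjoint_left]
    intro w hwm hwn
    exact hmn ((mem_sawWords.1 (Finset.mem_filter.1 hwm).1).1.symm.trans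
      (mem_sawWords.1 (Finset.mem_filter.1 hwn).1).1)
  refine (Finset.sum_le_sum fun n _ => hstep n).trans ?_
  rw [← Finset.sum_biUnion hdisj]

/-! ## `L(v) ≤ Λ_{v₀}` -/

/-- **`L(v) ≤ Λ_{v₀}`**: a bridge pinned at `v` has span `v₀`, so the pinned length-weighted mass of column
`h` is termwise below the length-weighted mass of all bridges of span `h`. [cite: MadrasSlade1993, §4.2] -/
theorem pinnedLengthMass_le_spanLengthMass {h : ℕ} {v : Site 2} (hv : v 0 = (h : ℤ)) :
    pinnedLengthMass v ≤ ∑' W : Bridge, if W.span = (h : ℤ) then (W.len : ℝ≥0∞) * W.mass else 0 := by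
  unfold pinnedLengthMass
  refine ENNReal.tsum_le_tsum fun W => ?_
  by_cases hW : W.tip = v
  · have hs : W.span = (h : ℤ) := by
      show W.tip 0 = (h : ℤ)
      rw [hW, hv]
    rw [if_pos hW, if_pos hs]
  · rw [if_neg hW]
    exact zero_le

/-! ## The effective floor -/

/-- **Effective floor under B1** (stub H7 of the line). From the word-model bound
`Σ_{bridge words w, span h, |w| ≤ N} |w| x_c^{|w|} ≤ 2 μ 4^h` (stub H6, the critical Hammersley–Welsh product
bound): (a) `Λ_h = Σ_{span W = h} |W| x_c^{|W|} ≤ 2 μ 4^h`; (b) `L(v) ≤ 2 μ 4^h` for every site `v` of column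
`h`; (c) `F(h) ≤ 2 · (2 μ 4^h)` (Fubini `Cut.freePairMass_le` and Kesten's bound `u_h ≤ 1`,
`Cut.columnMass_le_one`). [cite: MadrasSlade1993, §3.1; §4.2] -/
theorem pinnedLengthMass_le_exp_of : (∀ N h : ℕ, (∑ w ∈ (Finset.range (N + 1)).biUnion (fun n => (sawWords n).filter (fun w => IsBridgeW w ∧ xEnd w = (h : ℤ))), (w.length : ℝ) * criticalFugacity ^ w.length) ≤ 2 * connectiveConstant * 4 ^ h) → (∀ h : ℕ, (∑' W : Bridge, if W.span = (h : ℤ) then (W.len : ℝ≥0∞) * W.mass else 0) ≤ ENNReal.ofReal (2 * connectiveConstant * 4 ^ h)) ∧ (∀ (h : ℕ) (v : Site 2), v 0 = (h : ℤ) → pinnedLengthMass v ≤ ENNReal.ofReal (2 * connectiveConstant * 4 ^ h)) ∧ (∀ h : ℕ, freePairMass h ≤ 2 * ENNReal.ofReal (2 * connectiveConstant * 4 ^ h)) := by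
  intro hyp
  -- (a) `Λ_h ≤ 2 μ 4^h`
  have ha : ∀ h : ℕ, (∑' W : Bridge, if W.span = (h : ℤ) then (W.len : ℝ≥0∞) * W.mass else 0) ≤
      ENNReal.ofReal (2 * connectiveConstant * 4 ^ h) := by
    intro h
    rw [spanLengthMass_eq_tsum_sum, ENNReal.tsum_eq_iSup_nat]
    refine iSup_le fun N => ?_
    calc ∑ n ∈ Finset.range N, ∑ _ω ∈ (Zd.bridges 2 n).filter (fun ω => ω n 0 = (h : ℤ)),
            (n : ℝ≥0∞) * ENNReal.ofReal (criticalFugacity ^ n)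
        ≤ ∑ n ∈ Finset.range (N + 1), ∑ _ω ∈ (Zd.bridges 2 n).filter (fun ω => ω n 0 = (h : ℤ)),
            (n : ℝ≥0∞) * ENNReal.ofReal (criticalFugacity ^ n) :=
          Finset.sum_le_sum_of_subset (Finset.range_subset_range.2 (Nat.le_succ N))
      _ = ENNReal.ofReal (∑ n ∈ Finset.range (N + 1),
            ∑ _ω ∈ (Zd.bridges 2 n).filter (fun ω => ω n 0 = (h : ℤ)),
              (n : ℝ) * criticalFugacity ^ n) :=
          sum_range_lengthMass_eq_ofReal h N
      _ ≤ ENNReal.ofReal (2 * connectiveConstant * 4 ^ h) :=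
          ENNReal.ofReal_le_ofReal ((sum_range_lengthMass_le_wordSum h N).trans (hyp N h))
  -- (b) `L(v) ≤ Λ_{v₀} ≤ 2 μ 4^h`
  have hb : ∀ (h : ℕ) (v : Site 2), v 0 = (h : ℤ) →
      pinnedLengthMass v ≤ ENNReal.ofReal (2 * connectiveConstant * 4 ^ h) :=
    fun h _ hv => (pinnedLengthMass_le_spanLengthMass hv).trans (ha h)
  refine ⟨ha, hb, fun h => ?_⟩
  -- (c) `F(h) ≤ 2 u_h B ≤ 2 B`
  calc freePairMass h
      ≤ 2 * (columnMass h * ENNReal.ofReal (2 * connectiveConstant * 4 ^ h)) :=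
        Cut.freePairMass_le h _ (fun v hv => hb h v hv)
    _ ≤ 2 * (1 * ENNReal.ofReal (2 * connectiveConstant * 4 ^ h)) :=
        mul_le_mul' le_rfl (mul_le_mul' (Cut.columnMass_le_one h) le_rfl)
    _ = 2 * ENNReal.ofReal (2 * connectiveConstant * 4 ^ h) := by rw [one_mul]

end Summit.CriticalPhenomena.SAWScalingLimit.Theorems.CriticalBubbleBound.Kesten.HW

end
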